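import Literature.MathematicalPhysics.QuantumFieldTheory.Balaban1983to89.B8ExpMeanLogCrossTermUnitaryRec
import Literature.MathematicalPhysics.QuantumFieldTheory.Balaban1983to89.B8ExpMeanLogCrossTermRightConstRec
import Literature.MathematicalPhysics.QuantumFieldTheory.Balaban1983to89.B8ExpMeanLogOscFromPointwiseRec

/-!
# `Balaban1983to89.B8ExpMeanLogCrossTermCellRec` — [Balaban1985Averaging] (78)–(81) ∕ [Balaban1985RegularSpaces] (1.29): ROAD (B′)'s ROW 9′ AT ONE CELL IN THE `ℤᵈ`
# TRANSCRIPTION, ASSEMBLED — `‖R̄₀ʲ(τ·X⁻¹·u₀)(y) − 1‖ ≤ 1024·(4(ω_τ + ω_u))²` from the POINTWISE multiscale oscillations of the two unitary factors `τ` (the transformation between the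
# symmetric and the radial axial gauge) and `u₀` (Theorem 4's gauge, (1.29)-normalised at `y`), the cell datum `X := R̄₀ʲτ(y)` inserted as a block constant — the junction's ONE-CALL
# cell lemma (this seat's ✓p747787 → ✓p752835 → ✓p753816 → p755344 composed)

statement-level skeleton of published theorems with citation tags; proofs where landed; nothing here is a claim about the Yang–Mills mass gap

CITATION HEADER (lean-in-tree rule).  Cell `pub-ymgap` (HUMAN RULING D-0062), the N05-REC → K0-road JUNCTION (width seat `pub-ymgap-dag-n07-w3` g13).  [3] = [Balaban1985Averaging] (78)–(81)
p. 30, (166)–(167) p. 44; [6] = [Balaban1985RegularSpaces] (1.29) p. 81; [15] = [Balaban1985Variational] (147)–(154) pp. 301–302; [I] = [Balaban1987RG1] (0.3)–(0.4), (0.11) pp. 252–253.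
`--kind proof --supports stmt-QuantumFields-20541` (K0⁷; count-neutral; no definition).  REUSED BY NAME (all this seat's, g13): `B8ExpMeanLogCrossTermUnitaryRec.norm_uavgZ_one_mul_sub_one_le_of_unitary`
(the `U1`-free cross term), `B8ExpMeanLogCrossTermRightConstRec.{osc_row_mul_const_eq, uavgZ_one_mul_const_of_under}` (block constants), `B8ExpMeanLogOscFromPointwiseRec.{osc_rows_of_pointwise_under,
uavgZ_one_unitary_and_near_centre_under}` (rows from pointwise oscillation); dag-n05-e's `B7SectCDGaugeAveragesRec.uavgZ`, `B7Prop2Explicit.{unitaryUnits, unitaryUnits_le_U1}`, dag-n05-d's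
`B8Eq119TwistedAxialRec.{UnderZ, underZ_zero_iff}`.

WHY.  Row 9′ of the def of record (β′) at a cell `y` of `D″` reads, on the `ℤᵈ` cover, `R̄₀^{j′}(G)(y)` for `G = lift(h̄·w_s)·u⁻¹ = τ·h⁻¹·u₀` (road (B′): `u∘π = u₀⁻¹·h·vfix`, `τ :=
lift(h̄·w_s)·vfix⁻¹`, `h` the block-constant pre-composition with value `X(j′,y)` on the tower under `y`).  With the junction's CHOICE `X(j′,y) := R̄₀^{j′}τ(y)` the first factor `a = τ·X⁻¹`
is exactly normalised at `y` (right covariance), `u₀` is (1.29)-normalised there by Theorem 4, the (167)-rows of `a` are those of `τ` (✓p752835) and both factors' rows follow from their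
POINTWISE multiscale oscillations (✓p753816) — so the `U1`-free cross-term bound (p755344) gives `‖R̄₀^{j′}(G)(y) − 1‖ ≤ 1024·s²`, `s = 4(ω_τ + ω_u)`.  THIS FILE is that composition,
stated once, in the binder shapes the pointwise suppliers (✓p754021 for `τ`, ✓p755045 for `u₀`) produce.

WHAT IS PROVED (sorry-free; C⋆-algebra carrier).  ★★★ `norm_uavgZ_one_mul_const_mul_sub_one_le_of_pointwise` — `τ`, `u` unitary under the cell `y` (depth `j`) with pointwise multiscale
oscillations `ω_τ`, `ω_u` (`θ ≤ 1∕8`, `ω_τ + ω_u ≤ 1∕512`, `4096·θ·(ω_τ + ω_u) ≤ 1`), `g ≡ (R̄₀ʲτ(y))⁻¹` on the tower under `y`, `R̄₀ʲu(y) = 1` ⊢ `‖R̄₀ʲ(τ·g·u)(y) − 1‖ ≤ 1024·(4(ω_τ + ω_u))²`;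
★★ `norm_uavgZ_one_mul_inv_mul_sub_one_le_of_pointwise` — the same for `τ·h⁻¹·u` with `h ≡ R̄₀ʲτ(y)` under `y` (the knit's literal factorisation).
HONEST FRAMING: count-neutral helper; pure composition of this seat's landed lemmas — no analysis of [3]∕[6]∕[15]∕[I] asserted or discharged; the pointwise oscillation INPUTS (`τ`: the
sym-axial tree defect via ✓p754286∕✓p754516∕✓p754873 + dag-n07-e's 126∕127; `u₀`: structural #5 + the crown's bond letters via ✓p755045), the (0.4)-guard transcription torus↔`ℤᵈ` and the
KNIT are NOT here; `HThm4RecSym152PhiE(G)` ∕ `HThm4Rec*` UNDISCHARGED; N07 ∕ N05 NOT discharged; K0⁷ ∕ K1⁹ NOT closed; counts unmoved (typed 28∕28 · discharged 8∕28); one finite 𝕋⁴ programme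
at fixed ε — R4 closes the conditional finite-𝕋⁴ rung `BalabanLadder.UV` only; the YM mass gap (Clay) is NOT proved by any of this; nothing continuum ∕ ℝ⁴ ∕ OS.  No `def`, no `sorry`,
no `instance`, no `notation`.
-/

set_option autoImplicit false

noncomputable section

open scoped BigOperators

namespace Literature.MathematicalPhysics.QuantumFieldTheory.Balaban1983to89.B8ExpMeanLogCrossTermCellRec

open B7Prop1Explicit hiding Site
open B7Prop1Explicit renaming Site → SiteZ
open B7SectEFLinearisationRec (blockSitesZ)
open B7SectCDGaugeAveragesRec (uavgZ)
open B8Eq119TwistedAxialRec (UnderZ underZ_zero_iff)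
open B7Prop2Explicit (unitaryUnits unitaryUnits_le_U1)
open B8ExpMeanLogCrossTermUnitaryRec (norm_uavgZ_one_mul_sub_one_le_of_unitary)
open B8ExpMeanLogCrossTermRightConstRec (osc_row_mul_const_eq uavgZ_one_mul_const_of_under)
open B8ExpMeanLogOscFromPointwiseRec (osc_rows_of_pointwise_under uavgZ_one_unitary_and_near_centre_under)

variable {d : ℕ} {𝔹 : Type*} [CStarAlgebra 𝔹] [Nontrivial 𝔹]

/-- ★★★ **ROAD (B′)'s ROW 9′ AT ONE CELL, ASSEMBLED IN THE `ℤᵈ` TRANSCRIPTION** ([3] (78)–(81), [6] (1.29), [15] (147)–(154)): let `y` be a cell of level `j`, `τ` and `u` unitary at every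
fine site under `y` with POINTWISE multiscale oscillations `‖τ(L^{i+1}·z)⁻¹τ(w) − 1‖ ≤ ω_τ·θ^{j−(i+1)}`, `‖u(L^{i+1}·z)⁻¹u(w) − 1‖ ≤ ω_u·θ^{j−(i+1)}` (`z` under `y` at depth `j − (i+1)`, `w` under
`z`; `0 ≤ θ ≤ 1∕8`, `ω_τ + ω_u ≤ 1∕512`, `4096·θ·(ω_τ + ω_u) ≤ 1`), `g` EQUAL TO `(R̄₀ʲτ(y))⁻¹` on the tower under `y` (the inverse cell datum, a block constant) and `R̄₀ʲu(y) = 1` ((1.29) at `y`).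
Then `‖R̄₀ʲ(τ·g·u)(y) − 1‖ ≤ 1024·(4(ω_τ + ω_u))²`. [cite: Balaban1985Averaging, (78)–(81) p.30, (166)–(167) p.44; Balaban1985RegularSpaces, (1.29) p.81; Balaban1985Variational, (152)–(154) pp.301–302; Balaban1987RG1, (0.3)–(0.4) pp.252–253] -/
theorem norm_uavgZ_one_mul_const_mul_sub_one_le_of_pointwise {L : ℕ} (hL : Odd L) (τ g u : SiteZ d → 𝔹ˣ) (j : ℕ) (y : SiteZ d) {ωτ ωu θ : ℝ}
    (hθ0 : 0 ≤ θ) (hθ : θ ≤ 1 / 8) (hωτ0 : 0 ≤ ωτ) (hωu0 : 0 ≤ ωu) (hω : ωτ + ωu ≤ 1 / 512) (hθω : 4096 * θ * (ωτ + ωu) ≤ 1)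
    (hτ : ∀ x, UnderZ L j y x → τ x ∈ unitaryUnits 𝔹) (hu : ∀ x, UnderZ L j y x → u x ∈ unitaryUnits 𝔹)
    (hg : ∀ x, UnderZ L j y x → g x = (uavgZ L (1 : SiteZ d → Fin d → 𝔹ˣ) τ j y)⁻¹)
    (hptτ : ∀ i, i < j → ∀ z, UnderZ L (j - (i + 1)) y z → ∀ w, UnderZ L (i + 1) z w →
      ‖((((τ (((L : ℤ) ^ (i + 1)) • z))⁻¹ * τ w : 𝔹ˣ)) : 𝔹) - 1‖ ≤ ωτ * θ ^ (j - (i + 1)))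
    (hptu : ∀ i, i < j → ∀ z, UnderZ L (j - (i + 1)) y z → ∀ w, UnderZ L (i + 1) z w →
      ‖((((u (((L : ℤ) ^ (i + 1)) • z))⁻¹ * u w : 𝔹ˣ)) : 𝔹) - 1‖ ≤ ωu * θ ^ (j - (i + 1)))
    (hu1 : uavgZ L (1 : SiteZ d → Fin d → 𝔹ˣ) u j y = 1) :
    ‖((uavgZ L (1 : SiteZ d → Fin d → 𝔹ˣ) (τ * g * u) j y : 𝔹ˣ) : 𝔹) - 1‖ ≤ 1024 * (4 * (ωτ + ωu)) ^ 2 := by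
  have hωτ : ωτ ≤ 1 / 128 := by linarith
  have hωu : ωu ≤ 1 / 128 := by linarith
  have hyy : UnderZ L (j - j) y y := by rw [Nat.sub_self]; exact (underZ_zero_iff L y y).2 rfl
  -- the cell datum `X = R̄₀ʲτ(y)` is unitary
  set X : 𝔹ˣ := uavgZ L (1 : SiteZ d → Fin d → 𝔹ˣ) τ j y with hX
  have hXU : X ∈ unitaryUnits 𝔹 := (uavgZ_one_unitary_and_near_centre_under hL τ j y hθ0 hθ hωτ0 hωτ hτ hptτ j le_rfl y hyy).1
  have hXinvU : X⁻¹ ∈ unitaryUnits 𝔹 := (unitaryUnits 𝔹).inv_mem hXU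
  -- the first factor `a = τ·g` is unitary under the cell and exactly normalised at `y`
  have ha : ∀ x, UnderZ L j y x → (τ * g) x ∈ unitaryUnits 𝔹 := by
    intro x hx
    rw [Pi.mul_apply, hg x hx]
    exact (unitaryUnits 𝔹).mul_mem (hτ x hx) hXinvU
  have ha1 : uavgZ L (1 : SiteZ d → Fin d → 𝔹ˣ) (τ * g) j y = 1 := by
    rw [uavgZ_one_mul_const_of_under hL τ g X⁻¹ j y hg, mul_inv_cancel]
  -- the rows of the two factors from their pointwise oscillations
  have hpτ := osc_rows_of_pointwise_under hL τ j y hθ0 hθ hωτ0 hωτ hτ hptτ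
  have hqu := osc_rows_of_pointwise_under hL u j y hθ0 hθ hωu0 hωu hu hptu
  -- the rows of `a = τ·g` ARE those of `τ` (right block constant)
  have hpa : ∀ i, i < j → ∀ z, UnderZ L (j - (i + 1)) y z → ∀ x ∈ blockSitesZ L z,
      ‖(((uavgZ L (1 : SiteZ d → Fin d → 𝔹ˣ) (τ * g) i ((L : ℤ) • z))⁻¹ : 𝔹ˣ) : 𝔹) * ((uavgZ L (1 : SiteZ d → Fin d → 𝔹ˣ) (τ * g) i x : 𝔹ˣ) : 𝔹) - 1‖ ≤
        4 * ωτ * θ ^ (j - (i + 1)) := by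
    intro i hij z hz x hx
    have h := osc_row_mul_const_eq hL τ g X⁻¹ (unitaryUnits_le_U1 hXinvU) j y hg hij hz hx
    rw [Units.val_mul, Units.val_mul] at h
    rw [h]
    exact hpτ i hij z hz x hx
  -- the `U1`-free cross term with `s := 4(ω_τ + ω_u)`
  have h := norm_uavgZ_one_mul_sub_one_le_of_unitary hL (τ * g) u j y (fun i => 4 * ωτ * θ ^ (j - (i + 1))) (fun i => 4 * ωu * θ ^ (j - (i + 1)))
    (s := 4 * (ωτ + ωu)) (θ := θ)
    (fun i => by positivity) (fun i => by positivity) hθ0 (hθ.trans (by norm_num)) (by positivity) (by linarith) (by linarith)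
    (fun i _ => by ring_nf; exact le_rfl) ha hu hpa hqu ha1 hu1
  exact h

/-- ★★ **THE KNIT's LITERAL FACTORISATION `τ·h⁻¹·u₀`**: the same with the block constant entered as `h⁻¹`, `h ≡ R̄₀ʲτ(y)` on the tower under `y` (the pre-composition of road (B′) with the
junction's choice of the cell datum). [cite: Balaban1985Averaging, (78)–(81) p.30; Balaban1985RegularSpaces, (1.29) p.81; Balaban1985Variational, (152)–(154) pp.301–302] -/
theorem norm_uavgZ_one_mul_inv_mul_sub_one_le_of_pointwise {L : ℕ} (hL : Odd L) (τ h u : SiteZ d → 𝔹ˣ) (j : ℕ) (y : SiteZ d) {ωτ ωu θ : ℝ}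
    (hθ0 : 0 ≤ θ) (hθ : θ ≤ 1 / 8) (hωτ0 : 0 ≤ ωτ) (hωu0 : 0 ≤ ωu) (hω : ωτ + ωu ≤ 1 / 512) (hθω : 4096 * θ * (ωτ + ωu) ≤ 1)
    (hτ : ∀ x, UnderZ L j y x → τ x ∈ unitaryUnits 𝔹) (hu : ∀ x, UnderZ L j y x → u x ∈ unitaryUnits 𝔹)
    (hh : ∀ x, UnderZ L j y x → h x = uavgZ L (1 : SiteZ d → Fin d → 𝔹ˣ) τ j y)
    (hptτ : ∀ i, i < j → ∀ z, UnderZ L (j - (i + 1)) y z → ∀ w, UnderZ L (i + 1) z w →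
      ‖((((τ (((L : ℤ) ^ (i + 1)) • z))⁻¹ * τ w : 𝔹ˣ)) : 𝔹) - 1‖ ≤ ωτ * θ ^ (j - (i + 1)))
    (hptu : ∀ i, i < j → ∀ z, UnderZ L (j - (i + 1)) y z → ∀ w, UnderZ L (i + 1) z w →
      ‖((((u (((L : ℤ) ^ (i + 1)) • z))⁻¹ * u w : 𝔹ˣ)) : 𝔹) - 1‖ ≤ ωu * θ ^ (j - (i + 1)))
    (hu1 : uavgZ L (1 : SiteZ d → Fin d → 𝔹ˣ) u j y = 1) :
    ‖((uavgZ L (1 : SiteZ d → Fin d → 𝔹ˣ) (τ * h⁻¹ * u) j y : 𝔹ˣ) : 𝔹) - 1‖ ≤ 1024 * (4 * (ωτ + ωu)) ^ 2 :=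
  norm_uavgZ_one_mul_const_mul_sub_one_le_of_pointwise hL τ h⁻¹ u j y hθ0 hθ hωτ0 hωu0 hω hθω hτ hu
    (fun x hx => by rw [Pi.inv_apply, hh x hx]) hptτ hptu hu1

end Literature.MathematicalPhysics.QuantumFieldTheory.Balaban1983to89.B8ExpMeanLogCrossTermCellRec

end
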